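import Mathlib
import HarnessLib
import HarnessLib.Audit
import Summits.CriticalPhenomena.Statement
import Literature.Probability.RandomPlanarGeometry.SelfAvoidingWalk
import HarnessLib.Audit.Status.Attr

/-!
Route: SAWDimerizationRG

DORMANT since 2026-08-23T23:08:19Z (reconciler: no traction for 6.3 d (last activity item-evidence-added at 2026-08-17T14:48:10Z); parked, not closed — `ledger route dormant route-CriticalPhenomena-SAWDimerizationRG --off` to reactivate) — unstaffed, not closed; items shared with open routes are served there. `ledger route dormant <id> --off` reactivates.

# Route SAWDimerizationRG — dimerization as exact RG — canonical SAW limit as fusion fixed point (ν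
its eigenvalue), whole-plane rigidity, then condition to chordal SLE(8/3)

It suffices to show X = (E) ∧ (R) ∧ (D), realising card dimerization-exact-rg-fusion (spine). (E)
CanonicalLimit: the CANONICAL ensemble —
the uniform law U_n on n-step self-avoiding walks of ℤ² from 0 (always defined: no fugacity, no μ,
no G_{x_c} < ∞) — rescaled by some
deterministic r_n > 0 converges in law on CurveClass ℂ, as n → ∞ through ALL n, to a non-degenerate
probability law P*. Because
U_{2n} = Ψ(U_n) EXACTLY (a 2n-step SAW split at its midpoint is an ordered pair of n-step SAWs that
avoid each other; uniform conditions to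
uniform — MadrasSlade1993 Lemma 9.3.1, DimerizationBijection), the dyadic family is the forward
orbit of the one-step walk under the quadratic
FUSION MAP Ψ on laws, P* is a fixed point of the space-rescaled map Ψ_ν, and ν (conjecturally 3/4)
is the exponent at which the equation
balances. (R) FusionRigidity F* (informal until the fusion map and two-sided whole-plane SLE_{8/3}
are defined): fusion fixed point +
re-rooting stationarity + dilation covariance + D4 force ν = 3/4 and identify the two-sided law of
P* with two-sided whole-plane SLE_{8/3}
in its natural parametrisation (c = 0 is fusion-exactness: the Kozdron–Lawler loop term vanishes);
its typed shadow CanonicalIsotropy says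
every canonical limit is rotation invariant. (D) CanonicalToChordal: the critical chordal law in
(Ω_δ; a_δ, b_δ) is, exactly, the
x_c^n·c_n-mixture over n of U_n (started at a_δ) conditioned on {ω ⊂ Ω̄_δ, ω_n = b_δ}; identify P*
by (R), pass the conditioning and the
mixture to the limit, and read off chordal SLE_{8/3} with its natural length integrated out. Typed
envelope of (R)+(D): CanonicalLimit → SAWScalingLimit.
STATEMENT CONE (rev 1, route-repair 2026-08-15): every item is written over the sub-problem
Statement's own import cone — the finset
`SAW.Zd.saws 2 n` of n-step self-avoiding walks from 0 (vertex functions) and the concatenation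
`SAW.Zd.concatWalk` appear UNFOLDED to their
definitions (`(box 2 n).biUnion fun x => (((zdGraph 2).finsetWalkLength n 0 x).filter IsPath).image
getVert`, resp.
`fun i => if i ≤ m then ω i else ω m + υ (i - m)`), so the route file imports nothing beyond
`Summits.CriticalPhenomena.Statement` and no
unproved named fact (BDGS2012_*, EnumerationExponentConjecture2D, DisplacementExponentConjecture2D,
…) rides into its cone; the statements are
DEFINITIONALLY those of rev 0 and of the library (`Iff.rfl`: `uniformSAWCurveLaw n (r n)⁻¹`,
`uniformSAWCurveLaw_eq`, `bijOn_concatWalk` in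
Literature/Probability/RandomPlanarGeometry/UniformSAWCurveLaw.lean — provers import that file in
Theorems/ and rewrite by `rfl`).
Lean: `(∃ (r : ℕ → ℝ) (P : MeasureTheory.Measure
(Literature.Probability.RandomPlanarGeometry.CurveClass ℂ)), (∀ n, 0 < r n) ∧
MeasureTheory.IsProbabilityMeasure P ∧ P
(Literature.Probability.RandomPlanarGeometry.CurveClass.rangeSubset {0}) = 0 ∧ ∀ f :
BoundedContinuousFunction (Literature.Probability.RandomPlanarGeometry.CurveClass ℂ) ℝ,
Filter.Tendsto (fun n : ℕ => ∫ c, f c ∂((((Literature.Probability.LatticeModels.box 2 n).biUnion fun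
x => (((Literature.Probability.LatticeModels.zdGraph 2).finsetWalkLength n (0 :
Literature.Probability.LatticeModels.Site 2) x).filter fun p => p.IsPath).image fun p =>
p.getVert).card : ENNReal)⁻¹ • ∑ ω ∈ ((Literature.Probability.LatticeModels.box 2 n).biUnion fun x
=> (((Literature.Probability.LatticeModels.zdGraph 2).finsetWalkLength n (0 :
Literature.Probability.LatticeModels.Site 2) x).filter fun p => p.IsPath).image fun p => p.getVert),
MeasureTheory.Measure.dirac (Literature.Probability.RandomPlanarGeometry.CurveClass.mk
⟨Literature.Probability.LatticeModels.polyline ((List.range (n + 1)).map fun i =>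
Literature.Probability.LatticeModels.meshPoint (r n)⁻¹ (ω i))⟩))) Filter.atTop (nhds (∫ c, f c ∂P)))
∧ ((∃ (r : ℕ → ℝ) (P : MeasureTheory.Measure (Literature.Probability.RandomPlanarGeometry.CurveClass
ℂ)), (∀ n, 0 < r n) ∧ MeasureTheory.IsProbabilityMeasure P ∧ P
(Literature.Probability.RandomPlanarGeometry.CurveClass.rangeSubset {0}) = 0 ∧ ∀ f :
BoundedContinuousFunction (Literature.Probability.RandomPlanarGeometry.CurveClass ℂ) ℝ,
Filter.Tendsto (fun n : ℕ => ∫ c, f c ∂((((Literature.Probability.LatticeModels.box 2 n).biUnion fun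
x => (((Literature.Probability.LatticeModels.zdGraph 2).finsetWalkLength n (0 :
Literature.Probability.LatticeModels.Site 2) x).filter fun p => p.IsPath).image fun p =>
p.getVert).card : ENNReal)⁻¹ • ∑ ω ∈ ((Literature.Probability.LatticeModels.box 2 n).biUnion fun x
=> (((Literature.Probability.LatticeModels.zdGraph 2).finsetWalkLength n (0 :
Literature.Probability.LatticeModels.Site 2) x).filter fun p => p.IsPath).image fun p => p.getVert),
MeasureTheory.Measure.dirac (Literature.Probability.RandomPlanarGeometry.CurveClass.mk
⟨Literature.Probability.LatticeModels.polyline ((List.range (n + 1)).map fun i =>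
Literature.Probability.LatticeModels.meshPoint (r n)⁻¹ (ω i))⟩))) Filter.atTop (nhds (∫ c, f c ∂P)))
→ SAWScalingLimit)`

## Assembly
Pure logic (modus ponens; `assembly_holds` is sorry-free in Sketch.lean): CanonicalToChordal is the
implication CanonicalLimit → SAWScalingLimit,
so CanonicalLimit and CanonicalToChordal give the conjunct. FusionRigidity (rank 4, informal at
open) and CanonicalIsotropy are the intended
engine of CanonicalToChordal and enter the typed assembly when CanonicalToChordal is restated with
F* as an explicit hypothesis.

Rationale: WHY THIS LINE. Every other route of this sub-problem works in a DOMAIN (restriction, parafermion,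
FKG/RSW, LQG) and stalls on precompactness or on an
upgrade to conformal covariance; this line attacks the WHOLE-PLANE canonical object first, where
restriction has no hulls to act on but the
lattice has an exact nonlinear identity at every monomer: U_{2n} = Ψ(U_n) (MadrasSlade1993 Lemma
9.3.1; MadrasSokal1988; acceptance
c_{2n}/c_n² ≍ n^{1−γ}, LawlerSchrammWerner2004SAW §3.2.5), read here not as an algorithm but as an
exact real-space renormalisation acting
on LAWS (Jona-Lasinio/Sinai probabilistic RG; de Gennes' decimation along the chemical sequence made
exact and non-perturbative). Imported
areas: renormalisation-group dynamics (fixed point / eigenvalue / contraction ⇒ existence as orbit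
convergence, ν = 3/4 as nonlinear
eigenvalue, corrections to scaling Δ₁ = 3/2 of CaraccioloEtAl2005 as contraction rates) and the c =
0 structure of pairs of SLE_{8/3} arms
(KozdronLawler2007 configurational measure; LawlerLind2007 two-sided SLE_{8/3};
LawlerSchrammWerner2004SAW §3.4.6, §4.3 Predictions 7–8;
natural parametrisation LawlerSheffield2011, LawlerRezaei2015) for the identification. The canonical
ensemble removes two open inputs the
grand-canonical whole-plane approach needs (G_{x_c} < ∞ on ℤ², MadrasSlade1993 Table 1.2; the value
of μ), and the conditioning back to a
bounded domain (KennedyLawler2013 §4: the fixed-length ensemble simulates the others) meets card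
whole-plane-germ-interior-first only at (D).

RANKED CRUXES. #2 CanonicalLimit (crux) — (E) of the card (its r2, ORBIT CONVERGENCE): there are a
deterministic normalisation r_n > 0 and a probability law P on CurveClass ℂ giving no mass to the
constant curve such that the uniform n-step SAW from 0 on ℤ², drawn at mesh 1/r_n, converges in law
to P as n → ∞ (all bounded continuous test functions, ALL n — uneven splits U_{n+m} = (U_n ⊗ U_m ∣
avoid) are exact too). ν is an OUTPUT (r_{2n}/r_n → 2^ν is forced once P is unique and Ψ passes to
the limit), not an input. [difficulty: open-problem] (why it might fail: It IS whole-plane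
fixed-length existence (LSW04 §4.3): no crossing bound gives tightness of U_n, no monotone quantity
is known along the dimerization orbit, and Ψ's continuity at the limit is a singular conditioning;
two shape cluster points would falsify ∃(r,P).) [LawlerSchrammWerner2004SAW, MadrasSlade1993,
DuminilCopinHammond2013, arXiv:2310.17299, LawlerSheffield2011]
#3 CanonicalToChordal (crux) — (R)+(D) of the card in one typed envelope (its r3 + r4): the
existence of the canonical whole-plane limit implies the chordal conjunct. Intended proof: identify
P* by FusionRigidity (rank 4, informal until its definitions land), then use the EXACT lattice
dictionary — the critical chordal law in (Ω_δ; a_δ, b_δ) is the x_c^n·c_n-weighted mixture over n of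
U_n from a_δ conditioned on {ω ⊂ Ω̄_δ, ω_n = b_δ} (uniform conditions to uniform; no G_{x_c} < ∞
needed in a bounded domain) — and pass conditioning and mixture to the limit, obtaining chordal
SLE_{8/3} with its natural length integrated out. To be restated `CanonicalLimit → FusionRigidity →
…` when F* is typed. [deps: CanonicalLimit] [difficulty: open-problem] (why it might fail: Contains
F* AND a probability-0 conditioning: pinning U_n from a boundary point to stay in Ω and end at b_δ
costs N^(-25/64)·l(θ) per end (KennedyLawler2013 §2), lattice effects persist for boundary ensembles
(§4), and the mixture needs the tail of the natural-length law.) [KennedyLawler2013,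
LawlerSchrammWerner2004SAW, LawlerSheffield2011, LawlerRezaei2015, LawlerLind2007,
KozdronLawler2007]
#5 CanonicalIsotropy (crux) — typed shadow of F* where the barriers bite: EVERY canonical scaling
limit P (any normalisation r_n as in CanonicalLimit) is invariant under all rotations of the plane.
Under the card's rigidity (fusion-exactness + re-rooting stationarity + dilations + D4 ⇒
conformal-linear ⇒ two-sided SLE_{8/3}) this is forced; it is the interior, domain-free counterpart
of the (conf) clause the chordal routes cannot reach on ℤ². [deps: CanonicalLimit] [difficulty:
open-problem] (why it might fail: An upgrade D4 ⇒ all rotations from Euclidean+scale data alone is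
exactly what ScaleCovarianceNotMoebius / EmbeddingModulusUniqueness exclude; the extra input
(fusion-exactness + re-rooting) is untested as an upgrade mechanism, open even chordally (LSW04
p.3).) [Beffara2008, LawlerSchrammWerner2004SAW, Kennedy2004,
Literature.Barriers.CriticalPhenomena.EmbeddingModulusUniqueness,
Literature.Barriers.CriticalPhenomena.ScaleCovarianceNotMoebius]
#9 DimerizationBijection (support) — the exact layer (card r5): for all m, n, concatenation ω ⊕ (ω_m
+ υ) is a BIJECTION from the pairs (ω, υ) ∈ saws m × saws n whose pieces avoid each other onto saws
(m+n) (MadrasSlade1993 Lemma 9.3.1; hence U_{m+n} = push-forward of (U_m ⊗ U_n ∣ avoid), acceptance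
probability c_{m+n}/(c_m c_n)); the library now PROVES it for every d: `SAW.Zd.bijOn_concatWalk`
with the measure form `uniformSAWCurveLaw_add_eq_sum_avoidingPairs` (UniformSAWCurveLaw.lean; the
item is `fun m n => bijOn_concatWalk (d := 2) m n` after `Iff.rfl`). [difficulty: provable-now]
[MadrasSlade1993, MadrasSokal1988]

TWO-LAYER PLAN. Foreseen glued splits (none filed now): CanonicalLimit ⇐ CanonicalTight (tightness +
no atom at the constant curve for r_n := RMS end-to-end
distance; inputs DuminilCopinHammond2013, Madras' ⟨|ω_n|²⟩ ≥ n^{4/3}/C, arXiv:2310.17299) →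
UniqueClusterPoint (all subsequential limits agree:
the fixed-point/Lyapunov content) → CanonicalLimit. CanonicalToChordal ⇐ FusionRigidity (typed, once
defn FusionMapOnCurveLaws /
TwoSidedWholePlaneSLE land) → ConditionAndMix (P* identified ⇒ conditioned canonical laws converge
and the x_c^n-mixture is chordal SLE_{8/3})
→ CanonicalToChordal. FusionRigidity ⇐ TwoSidedSLEIsFixedPoint (Lawler–Lind's law satisfies
(a),(b),(c) exactly) → FixedPointUnique → FusionRigidity.

KILL CRITERIA. A SECOND fusion fixed point in the D4-symmetric, re-rooting-stationary,
dilation-covariant class — found numerically (iterated dimerization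
from perturbed initial laws not flowing back to the SAW orbit) or built in the continuum (e.g. an
anisotropic self-similar solution) —
refutes FusionRigidity and with it the identification step: close `refuted:FusionRigidity` unless
one extra exact lattice symmetry (pivot
invariance, reversal) provably restores uniqueness (then restate). ¬CanonicalIsotropy (an
anisotropic canonical subsequential limit) kills the
route and every conformal-invariance route on ℤ² alike. ¬CanonicalLimit by two distinct shape
cluster points forces a pivot to a subsequential
thesis (rigidity applied to cluster points). CanonicalToChordal can only die together with the
conjunct. SAWScalingLimit proved elsewhere
moots (D) but leaves CanonicalLimit/F* as the whole-plane programme (LSW04 Predictions 7–8), outside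
this summit.

NOT DECOMPOSED YET. The value ν = 3/4 (kept out of CanonicalLimit on purpose: it is the eigenvalue,
to be READ OFF via r_{2n}/r_n → 2^ν once Ψ is shown
continuous at P*); tightness of U_n and the Lyapunov functional for Ψ (children of CanonicalLimit);
the precise form of the singular
'disjoint forever' conditioning (h-transform and its exponent for an unknown law) inside F*; the
finite-window ↔ two-sided-infinite tilt
(continuation function) relating P* to Lawler–Lind's object; boundary pinning exponents (25/64) and
natural-length tails inside (D);
corrections-to-scaling reading (C) of the card (Δ = 1, 3/2 as contraction rates) — evidence, not an
item.

CHEAPEST FALSIFIER. The card's r6 experiment (not run here: no kit in this unit): pivot-sample U_n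
for n = 2^10 … 2^16 (Madras–Sokal/Clisby pivot), (i) code-check
U_{2n} = Ψ(U_n) on shape observables (radius-of-gyration ratio, winding, midpoint-chord
left-passage) — an identity; (ii) iterate Ψ from
perturbed initial laws (semiflexible walks of stiffness s, finite-memory walks): the deviation from
the U-orbit must decay like 2^{−kΔ} with
Δ ∈ {1, 3/2} (CaraccioloEtAl2005) and residual ROTATIONAL ANISOTROPY of the iterates must decay too;
a non-decaying deviation or anisotropy
(a second D4-symmetric fixed point) retires F*, CanonicalIsotropy's mechanism and the universality
reading at once. Lookup falsifier: a
printed characterisation/uniqueness theorem for two-sided whole-plane SLE_{8/3} by fusion-type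
axioms (searched: none found; LawlerLind2007
construct, do not characterise).

NUMBERS. ν = 3/4 (Flory; LawlerSchrammWerner2004SAW Prediction 2), γ = 43/32 so the dimerization
acceptance c_{2n}/c_n² ≍ n^{1−γ} = n^{−11/32}
(LSW04 §3.2.5; MadrasSlade1993 (9.3.2): E τ = c_M c_N / c_{M+N}); Δ₁ = 3/2 and the analytic n^{−1}
(CaraccioloEtAl2005); boundary pinning
exponent ρ = 25/64 and lattice factor l(θ) (KennedyLawler2013 §2); μ ∈ [2.6, 2.7] (in-tree fact
Literature.Probability.RandomPlanarGeometry.SAW.LawlerSchrammWerner2004SAW_connectiveConstant_bounds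
— NOT needed by this route); rigorous
window for cluster points: sub-ballistic (DuminilCopinHammond2013; quantitative on Hex
arXiv:2310.17299) and ⟨|ω_n|²⟩ ≥ n^{4/3}/C (Madras 2014),
i.e. ν ∈ [2/3, 1]. Items at open: 5 typed (+1 informal crux, +3 definition requests filed after
open). Cone (rev 1): 0 route-specific Literature imports, needs-fact: none
(rev 0 imported SAWBridges → SAWCount → BDGS2012.lean, 15 named facts incl. two conjectures, none
used by any item).

DEFINITION REQUESTS. Filed right after open (`ledger workitem add --kind definition`):
UniformSAWCurveLaw — LANDED
(Literature/Probability/RandomPlanarGeometry/UniformSAWCurveLaw.lean: `uniformSAWCurveLaw n s`,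
syntactically the rev-0 / definitionally the rev-1 measure of
CanonicalLimit/CanonicalIsotropy; D4 symmetry, dilation covariance, reversal, `bijOn_concatWalk`,
`card_avoidingPairs`; it imports SAWBridges, so it is
used from Theorems files, never from the route file — statement cone kept fact-free);
FusionMapOnCurveLaws (new object for this problem: laws of naturally parametrised rooted planar
curves, the ε-regularised
disjoint-concatenation map Ψ_ν with dilation 2^{−ν} and its ε → 0 limit, and the re-rooting shift of
two-sided parametrised curves — needed to
type FusionRigidity); TwoSidedWholePlaneSLE (Literature/Probability/RandomPlanarGeometry: two-sided
whole-plane SLE_{8/3} through 0 with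
natural parametrisation — LawlerLind2007, LawlerSchrammWerner2004SAW §3.4.6/§4.3,
LawlerSheffield2011, LawlerRezaei2015). Informal crux filed
after open: FusionRigidity (rank 4).

Novelty: Searches (2026-08-15): `lit search --hybrid "dimerization self-avoiding walk uniform n-step
concatenation Madras Sokal pivot"` (12 docs;
MadrasSlade1993 §9.3.2 pdf pp.319–321 read); `lit search --hybrid "natural parametrization SLE
self-avoiding walk fixed length …"` (12);
`lit search --source crossref` ×3 (Lawler–Sheffield doi:10.1214/10-aop560; Lawler–Lind
doi:10.1090/fic/050/11 + Lawler 2020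
doi:10.1214/20-ejp476 two-sided LERW; Kozdron–Lawler doi:10.1090/fic/050/09); `lit frontier
CriticalPhenomena --since 2020` (30 rows; SAW
only arXiv:2310.17299); `lit bridges CriticalPhenomena --cross any` (30; nothing on chain-length
RG); `lit galaxy search "…natural
parametrization…" --star all` and `"two-sided SLE" --star pdf` (galaxyd saturated, rc queued > 90 s,
logged); `lit galaxy search
"renormalization along the chemical sequence" --star panama` (1 hit: panama:467644629123080, Binder
(ed.), Applications of the Monte Carlo
Method in Statistical Physics — Kremer–Binder MC renormalisation in chain length; read blocked by
saturation); `--star panama --title-contains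
self-avoiding "dimerization"` (1: MadrasSlade1993); reads LSW04 arXiv:math/0204277 pp.11,14–15,17,
arXiv:0906.3804 pp.3–4, arXiv:1109.3091
pp.7,11; plus the refuter audit of the card (de Gennes 1979 ch. XI.1 read: g^ν = a_m/a_{m−1}, γ−1
from end effects; Jona-Lasinio 1975 /
Sinai 1976 probabilistic RG).
Nearest prior art found: de Gennes 1979 XI.1 and Kremer–Binder (panama:467644629123080) — ν as
eigenvalue of an APPRO  [refs: 10.1214/10-aop560, 10.1090/fic/050/11, 10.1214/20-ejp476, 10.1090/fic/050/09, 2310.17299, math/0204277, 0906.3804, 1109.3091, doi:10.1214/10-aop560, doi:10.1090/fic/050/11, doi:10.1214/20-ejp476, doi:10.1090/fic/050/09, MadrasSlade1993, MadrasSokal1988, LawlerLind2007, KozdronLawler2007]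

Barriers (technique_class: exact-quadratic-rg, fusion-fixed-point, canonical-ensemble): - technique_class: exact-quadratic-rg, fusion-fixed-point, canonical-ensemble
- Literature.Barriers.CriticalPhenomena.SAWNotKineticallyGrown: consistent and used positively — Ψ
acts on laws of WHOLE walks (configurational U_n), never on growth kernels; the non-consistency of
(U_n) (not_isConsistent_uniformSAW) is exactly what the fusion identity replaces (U_{2n} from U_n ⊗
U_n by conditioning, not by extension).
- Literature.Barriers.CriticalPhenomena.RigorousRGSmallParameter: applies to any proof of
contraction of Ψ near P* by expansion (no small parameter, ε = 1 world); it does not evade it; the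
bet is that an EXACT quadratic map on laws admits soft fixed-point/compactness arguments
(CanonicalLimit) and a rigidity theorem (F*) where approximate RG maps admit neither — contraction
is measured (cheapest falsifier), not expanded.
- Literature.Barriers.CriticalPhenomena.EmbeddingModulusUniqueness: engaged at CanonicalIsotropy/F*:
fusion and re-rooting are embedding-blind, so a sheared embedding of ℤ² yields the sheared fixed
point — consistent with Beffara; D4 of the standard embedding is spent explicitly as an axiom of F*,
and isotropy is claimed only for meshPoint (square) embeddings; honest residue: whether
fusion-exactness is a genuine upgrade input is the open bet (kill criterion).
- Literature.Barriers.CriticalPhenomena.ScaleCovarianceNotMoebius: its witness (Euclidean + scale ⇏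
Möbius, d = 3 correlation family) has no fusion/re-rooting structure; F* adds exactly these tw

Novelty grade: new-combination — ROUTE REVIEW (refuter, 2026-08-15). NOVELTY new-combination: the EXACT dimerization identity on laws (Madras–Sokal/Madras–Slade; de Gennes' decimation and Kremer–Binder's MC RG treat the same move approximately) read as a quadratic RG whose fixed point is the canonical whole-plane limit, joined with (refuter refuter-rreview-route-CriticalPhenomena--7dc828c2-0, 2026-08-15T14:02:50Z; prior: MadrasSlade1993 Lemma 9.3.1 / MadrasSokal1988 (dimerization identity U_{m+n} = (U_m ⊗ U_n | avoid)), de Gennes 1979 ch. XI.1; Kremer–Binder MC renormalisation in chain length (panama:467644629123080) — ν as eigenvalue of an APPROXIMATE chain-length RG, arXiv:math/0204277 (LSW04 §3.2.5, §4.3 Predictions 7–8), doi:10.1090/fic/050/11 (Lawler–Lind two-sided SLE8/3), doi:10.1090/fic/050/09 (Kozdron–Law)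

History (route lifecycle, newest last):
- 2026-08-15T16:21:16Z · rev 1: restated CanonicalLimit (stmt-CriticalPhenomena-5723), CanonicalIsotropy (stmt-CriticalPhenomena-5725), DimerizationBijection (stmt-CriticalPhenomena-5726) — route-repair (unit rbadge-CriticalPhenomena-SAWDimerizati-d5287370-g4): (1) GLUE: theorem closes (h1 : CanonicalLimit) (h2 : CanonicalToChordal) : SAWScali (planner-rbadge-CriticalPhenomena-SAWDimerizati-d5287370-g4-0)
- 2026-08-23T23:08:19Z · DORMANT — reconciler: no traction for 6.3 d (last activity item-evidence-added at 2026-08-17T14:48:10Z); parked, not closed — `ledger route dormant route-CriticalPhenomen (operator:999:1189686)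

sub-problem: SAWScalingLimit · status: dormant · opened planner-plancard-CriticalPhenomena-SAWScaling-e75a662a-0 2026-08-15T11:42:14Z · rev 2 · ledger route-CriticalPhenomena-SAWDimerizationRG
GENERATED by the gate from the ledger (D-0016/17). Provers cite these decls: `theorem foo : Summit.CriticalPhenomena.SAWScalingLimit.Theses.SAWDimerizationRG.<Decl> := …` in Summits/CriticalPhenomena/SAWScalingLimit/Theorems/<Name>.lean.
-/

namespace Summit.CriticalPhenomena.SAWScalingLimit.Theses.SAWDimerizationRG

open scoped BigOperators Topology Manifold Classical MeasureTheory ProbabilityTheory Matrix InnerProductSpace ComplexConjugate ContinuousMap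
open Filter Set Function TopologicalSpace MeasureTheory

attribute [summit_statement] _root_.SAWScalingLimit

-- earlier CanonicalLimit (stmt-CriticalPhenomena-5723, replaced 2026-08-15T16:21:16Z -> stmt-CriticalPhenomena-10693): retired by None — ∃ (r : ℕ → ℝ) (P : MeasureTheory.Measure (Literature.Probability.RandomPlanarGeometry.CurveClass ℂ)), (∀ n, 0 < r n) ∧ MeasureTheory.IsProbabilityMeasure P ∧ P (Literature.Probability.RandomPlanarGeometry.CurveClass.rangeSubset {0}) = 0 ∧ ∀ f : BoundedContinuousFun
/-- item stmt-CriticalPhenomena-10693 · crux · rank 2 · open · by planner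
why it might fail: It IS whole-plane fixed-length existence (LSW04 §4.3): no crossing bound gives tightness of U_n, no monotone quantity is known along the dimerization orbit, and Ψ's continuity at the limit is a singular conditioning; two shape cluster points would falsify ∃(r,P).
sources: LawlerSchrammWerner2004SAW, MadrasSlade1993, DuminilCopinHammond2013, arXiv:2310.17299, LawlerSheffield2011
[crux] (E) of the card (its r2, ORBIT CONVERGENCE): there are a deterministic normalisation r_n > 0
and a probability law P on CurveClass ℂ giving no mass to the constant curve such that the uniform
n-step SAW from 0 on ℤ², drawn at mesh 1/r_n, converges in law to P as n → ∞ (all bounded continuous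
test functions, ALL n — uneven splits U_{n+m} = (U_n ⊗ U_m ∣ avoid) are exact too). ν is an OUTPUT
(r_{2n}/r_n → 2^ν is forced once P is unique and Ψ passes to the limit), not an input. [difficulty:
open-problem] (rev 1: the uniform law is written with `SAW.Zd.saws 2 n` unfolded to its definition —
definitionally `uniformSAWCurveLaw n (r n)⁻¹` of UniformSAWCurveLaw.lean, `Iff.rfl`.) -/
@[route_item "route-CriticalPhenomena-SAWDimerizationRG", crux]
def CanonicalLimit : Prop :=
  ∃ (r : ℕ → ℝ) (P : MeasureTheory.Measure (Literature.Probability.RandomPlanarGeometry.CurveClass ℂ)), (∀ n, 0 < r n) ∧ MeasureTheory.IsProbabilityMeasure P ∧ P (Literature.Probability.RandomPlanarGeometry.CurveClass.rangeSubset {0}) = 0 ∧ ∀ f : BoundedContinuousFunction (Literature.Probability.RandomPlanarGeometry.CurveClass ℂ) ℝ, Filter.Tendsto (fun n : ℕ => ∫ c, f c ∂((((Literature.Probability.LatticeModels.box 2 n).biUnion fun x => (((Literature.Probability.LatticeModels.zdGraph 2).finsetWalkLength n (0 : Literature.Probability.LatticeModels.Site 2) x).filter fun p => p.IsPath).image fun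 p => p.getVert).card : ENNReal)⁻¹ • ∑ ω ∈ ((Literature.Probability.LatticeModels.box 2 n).biUnion fun x => (((Literature.Probability.LatticeModels.zdGraph 2).finsetWalkLength n (0 : Literature.Probability.LatticeModels.Site 2) x).filter fun p => p.IsPath).image fun p => p.getVert), MeasureTheory.Measure.dirac (Literature.Probability.RandomPlanarGeometry.CurveClass.mk ⟨Literature.Probability.LatticeModels.polyline ((List.range (n + 1)).map fun i => Literature.Probability.LatticeModels.meshPoint (r n)⁻¹ (ω i))⟩))) Filter.atTop (nhds (∫ c, f c ∂P))

/-- item stmt-CriticalPhenomena-5724 · crux · rank 3 · open · by planner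
why it might fail: Contains F* AND a probability-0 conditioning: pinning U_n from a boundary point to stay in Ω and end at b_δ costs N^(-25/64)·l(θ) per end (KennedyLawler2013 §2), lattice effects persist for boundary ensembles (§4), and the mixture needs the tail of the natural-length law.
sources: KennedyLawler2013, LawlerSchrammWerner2004SAW, LawlerSheffield2011, LawlerRezaei2015, LawlerLind2007, KozdronLawler2007
[crux] (R)+(D) of the card in one typed envelope (its r3 + r4): the existence of the canonical
whole-plane limit implies the chordal conjunct. Intended proof: identify P* by FusionRigidity (rank
4, informal until its definitions land), then use the EXACT lattice dictionary — the critical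
chordal law in (Ω_δ; a_δ, b_δ) is the x_c^n·c_n-weighted mixture over n of U_n from a_δ conditioned
on {ω ⊂ Ω̄_δ, ω_n = b_δ} (uniform conditions to uniform; no G_{x_c} < ∞ needed in a bounded domain)
— and pass conditioning and mixture to the limit, obtaining chordal SLE_{8/3} with its natural
length integrated out. To be restated `CanonicalLimit → FusionRigidity → …` when F* is typed. [deps:
CanonicalLimit] [difficulty: open-problem] -/
@[route_item "route-CriticalPhenomena-SAWDimerizationRG", crux]
def CanonicalToChordal : Prop :=
  CanonicalLimit → SAWScalingLimit

-- earlier CanonicalIsotropy (stmt-CriticalPhenomena-5725, replaced 2026-08-15T16:21:16Z -> stmt-CriticalPhenomena-10694): retired by None — ∀ (r : ℕ → ℝ) (P : MeasureTheory.Measure (Literature.Probability.RandomPlanarGeometry.CurveClass ℂ)), (∀ n, 0 < r n) → MeasureTheory.IsProbabilityMeasure P → P (Literature.Probability.RandomPlanarGeometry.CurveClass.rangeSubset {0}) = 0 → (∀ f : BoundedContinuou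
/-- item stmt-CriticalPhenomena-10694 · crux · rank 5 · open · by planner
why it might fail: An upgrade D4 ⇒ all rotations from Euclidean+scale data alone is exactly what ScaleCovarianceNotMoebius / EmbeddingModulusUniqueness exclude; the extra input (fusion-exactness + re-rooting) is untested as an upgrade mechanism, open even chordally (LSW04 p.3).
sources: Beffara2008Universal, LawlerSchrammWerner2004SAW, Kennedy2004, Literature.Barriers.CriticalPhenomena.EmbeddingModulusUniqueness, Literature.Barriers.CriticalPhenomena.ScaleCovarianceNotMoebius
[crux] typed shadow of F* where the barriers bite: EVERY canonical scaling limit P (any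
normalisation r_n as in CanonicalLimit) is invariant under all rotations of the plane. Under the
card's rigidity (fusion-exactness + re-rooting stationarity + dilations + D4 ⇒ conformal-linear ⇒
two-sided SLE_{8/3}) this is forced; it is the interior, domain-free counterpart of the (conf)
clause the chordal routes cannot reach on ℤ². [deps: CanonicalLimit] [difficulty: open-problem] (rev
1: the uniform law is written with `SAW.Zd.saws 2 n` unfolded to its definition — definitionally
`uniformSAWCurveLaw n (r n)⁻¹` of UniformSAWCurveLaw.lean, `Iff.rfl`.) -/
@[route_item "route-CriticalPhenomena-SAWDimerizationRG"]
def CanonicalIsotropy : Prop :=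
  ∀ (r : ℕ → ℝ) (P : MeasureTheory.Measure (Literature.Probability.RandomPlanarGeometry.CurveClass ℂ)), (∀ n, 0 < r n) → MeasureTheory.IsProbabilityMeasure P → P (Literature.Probability.RandomPlanarGeometry.CurveClass.rangeSubset {0}) = 0 → (∀ f : BoundedContinuousFunction (Literature.Probability.RandomPlanarGeometry.CurveClass ℂ) ℝ, Filter.Tendsto (fun n : ℕ => ∫ c, f c ∂((((Literature.Probability.LatticeModels.box 2 n).biUnion fun x => (((Literature.Probability.LatticeModels.zdGraph 2).finsetWalkLength n (0 : Literature.Probability.LatticeModels.Site 2) x).filter fun p => p.IsPath).image fun p => p.getVert).card : ENNReal)⁻¹ • ∑ ω ∈ ((Literature.Probability.LatticeModels.box 2 n).biUnion fun x => (((Literature.Probability.LatticeModels.zdGraph 2).finsetWalkLength n (0 : Literature.Probability.LatticeModels.Site 2) x).filter fun p => p.IsPath).image fun p => p.getVert), MeasureTheory.Measure.dirac (Literature.Probability.RandomPlanarGeometry.CurveClass.mk ⟨Literature.Probability.LatticeModels.polyline ((List.range (n + 1)).map fun i => Literature.Probability.LatticeModels.meshPoint (r n)⁻¹ (ω i))⟩)))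 Filter.atTop (nhds (∫ c, f c ∂P))) → ∀ θ : ℝ, P.map (Literature.Probability.RandomPlanarGeometry.CurveClass.map (⟨fun z : ℂ => Complex.exp (↑θ * Complex.I) * z, continuous_const_mul _⟩ : C(ℂ, ℂ))) = P

-- item stmt-CriticalPhenomena-6821 · support · rank 4 · open · by planner — informal only, no Lean statement yet:
--   [crux] F* — FUSION RIGIDITY (card dimerization-exact-rg-fusion, its r3; informal until defn
--   FusionMapOnCurveLaws and defn TwoSidedWholePlaneSLE land). Setting: probability laws P on simple
--   planar curves from 0 carrying a parametrisation ('natural length'; unit total length), together with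
--   the associated TWO-SIDED law P^(2) (P re-rooted at its midpoint: an ordered pair of arms of length
--   1/2 from 0, vertex-disjoint except at 0). Axioms, each an exact inheritance from the lattice
--   identity U_{n+m} = (U_n ⊗ U_m | avoid): (a) FUSION FIXED POINT with exponent ν: for every split
--   ratio t in (0,1), P eq

-- earlier DimerizationBijection (stmt-CriticalPhenomena-5726, replaced 2026-08-15T16:21:16Z -> stmt-CriticalPhenomena-10695): retired by None — ∀ m n : ℕ, Set.BijOn (fun p : (ℕ → Literature.Probability.LatticeModels.Site 2) × (ℕ → Literature.Probability.LatticeModels.Site 2) => Literature.Probability.RandomPlanarGeometry.SAW.Zd.concatWalk m p.1 p.2) {p | p.1 ∈ Literature.Probability.RandomPlanarGeom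
/-- item stmt-CriticalPhenomena-10695 · support · rank 9 · open · by planner
sources: MadrasSlade1993, MadrasSokal1988
[support] the exact layer (card r5): for all m, n, concatenation ω ⊕ (ω_m + υ) is a BIJECTION from
the pairs (ω, υ) ∈ saws m × saws n whose pieces avoid each other onto saws (m+n) (MadrasSlade1993
Lemma 9.3.1; hence U_{m+n} = push-forward of (U_m ⊗ U_n ∣ avoid), acceptance probability
c_{m+n}/(c_m c_n)); stated with `saws`/`concatWalk` unfolded to their definitions (rev 1, statement
cone = Statement cone); the library proves it for every d: `SAW.Zd.bijOn_concatWalk`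
(UniformSAWCurveLaw.lean), so the item is `fun m n => bijOn_concatWalk (d := 2) m n` after
`Iff.rfl`. [difficulty: provable-now] -/
@[route_item "route-CriticalPhenomena-SAWDimerizationRG"]
def DimerizationBijection : Prop :=
  ∀ m n : ℕ, Set.BijOn (fun p : (ℕ → Literature.Probability.LatticeModels.Site 2) × (ℕ → Literature.Probability.LatticeModels.Site 2) => fun i => if i ≤ m then p.1 i else p.1 m + p.2 (i - m)) {p | (p.1 ∈ (Literature.Probability.LatticeModels.box 2 m).biUnion fun x => (((Literature.Probability.LatticeModels.zdGraph 2).finsetWalkLength m (0 : Literature.Probability.LatticeModels.Site 2) x).filter fun q => q.IsPath).image fun q => q.getVert) ∧ (p.2 ∈ (Literature.Probability.LatticeModels.box 2 n).biUnion fun x => (((Literature.Probability.LatticeModels.zdGraph 2).finsetWalkLength n (0 : Literature.Probability.LatticeModels.Site 2) x).filter fun q => q.IsPath).image fun q => q.getVert) ∧ ∀ i ≤ m, ∀ j, 1 ≤ j → j ≤ n → p.1 i ≠ p.1 m + p.2 j} ↑((Literature.Probability.LatticeModels.box 2 (m + n)).biUnion fun x => (((Literature.Probability.LatticeModels.zdGraph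 2).finsetWalkLength (m + n) (0 : Literature.Probability.LatticeModels.Site 2) x).filter fun q => q.IsPath).image fun q => q.getVert)

/-- item stmt-CriticalPhenomena-5727 · assembly · rank 1 · open · by planner
sources: LawlerSchrammWerner2004SAW, MadrasSlade1993
[assembly] CanonicalLimit → CanonicalToChordal → SAWScalingLimit. -/
@[route_item "route-CriticalPhenomena-SAWDimerizationRG"]
def Assembly : Prop :=
  CanonicalLimit → CanonicalToChordal → SAWScalingLimit

/-! D-0027 §2.1 — DECIDING THEOREM (planner-authored via `route open/edit --closes-file`; by planner-rbadge-CriticalPhenomena-SAWDimerizati-d5287370-g4-0 2026-08-15T16:21:16Z):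
its hypotheses are this route's items and its conclusion the sub-problem Statement (glue_lint), and it elaborates with this file. -/

/-- Deciding theorem (D-0027 §2.1). The route's typed layer is (E) `CanonicalLimit` (the uniform
`n`-step SAW on `ℤ²`, rescaled, converges in law to a non-degenerate `P*`) and the envelope
`CanonicalToChordal : CanonicalLimit → SAWScalingLimit` ((R) fusion rigidity + (D) exact
conditioning/mixture to the critical chordal law); the conjunct follows by modus ponens. -/
@[closes "route-CriticalPhenomena-SAWDimerizationRG"] theorem closes (h₁ : CanonicalLimit) (h₂ : CanonicalToChordal) : SAWScalingLimit :=
  h₂ h₁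

end Summit.CriticalPhenomena.SAWScalingLimit.Theses.SAWDimerizationRG
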